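import Summits.AtomisticToContinuum.Crystallization.Theorems.OverbindingBudgetAffineCompressedCutStep

/-!
# NODE g81 «ExactStep», toward the open leaf NS♭₂ — the EXACT DICTIONARY of a registered bond and its COCYCLE (rider R1, real side)

Route `OverbindingBudget` (Crystallization), crux `RobustDefectLimitWindows` (stmt-AtomisticToContinuum-31280), decomp-a2c lens 4, generation 81.
Plan of record (critic rows 1421/1423/1428): the residual leaf `…CompressedCutFirst.NearFieldSlackMinSecond 12 (1/25)` is reduced to LAYER RIGIDITY `LR(r₁)`;
its first rider «ExactStep» re-opens the record transport step `…CompressedCutStep.transport_step_record` and upgrades it from "an isometry `R₁` through one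
tetrahedral frame" to the FULL EXACT DICTIONARY of the bond `j → k = f v_k` (`v_k` a first-shell point of `j`'s pattern `P`, frames at the record literals
`(ε, θ, g) = (10⁻⁴, 10⁻³, 1/450)`, scales compared by the SCALE half `9967/10⁴·nn_j ≤ nn_k ≤ 10011/10⁴·nn_j`):

* §1 linear algebra of `ℝ³`: a vector is determined by its inner products against a tetrahedral unit triple (`eq_of_inner_eq_tetra`); linear maps agreeing
  on an independent triple agree (`linearMap_eq_of_eq_on_triple`); `linearIndependent_partners`;
* §2 `norm_sub_class_of_reach`: distinct pattern points within the record reach `149/100` are at distance `1` or `√2` (class set of `…Classes`);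
* §3 `ExactDict y j P P' f f' v_k R₁` — the back-pointer `w₀ ∈ P'` (`f' w₀ = y j`) has `R₁ w₀ = −v_k`, and EVERY `v ∈ P`, `v ≠ v_k`, `‖v − v_k‖ ≤ 149/100` has a
  dictionary partner `w ∈ P'` registering the same site, `f' w = f v`, with `R₁ w = v − v_k` EXACTLY; ★★ `exact_step_record`: such an `R₁` exists together with
  the op-norm transport bound of `transport_step_record` (proof: that record's tetrahedral frame `w₀, w₁, w₂ ↦ −v_k, b − v_k, c − v_k`, then for every
  dictionary pair Gram exactness `…Classes.dict_gram_record` against the frame and `eq_of_inner_eq_tetra`);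
* §4 `exactDict_unique` (the exact dictionary pins `R₁`) and ★ `exactDict_cocycle`: for a registered TRIANGLE of sites `j, j₂ = f e, k = f v_k` with exact
  dictionaries `R` (`j₂ → j`), `R₁` (`k → j`), `R₁'` (`k → j₂`) and one more common registered point `a` with `v_k, e, a` independent, `R ∘ R₁' = R₁` — the
  two parents `j, j₂` induce THE SAME chart on the child `k` (obligation O5 of critic row 1428: registration is frame-choice independent).

The integer side (charts `E → ℤ³/√18`, `RegAt` / `PullsInto` of `…CompressedCutKernel` from exact dictionaries) is the sibling rider `…CompressedCutCharts`.
Deps: tree only (`…CompressedCutStep` ⊇ Classes ⊇ Dict, Transfer, Op).  No `instance`, no `notation`, no `set_option`, no new axioms, 0 sorry.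
-/

namespace Summit.AtomisticToContinuum.Crystallization.Theorems.OverbindingBudgetAffineCompressedCutExact

open Literature.Geometry.DiscreteGeometry (nearestDist nearestDist_nonneg fccTwoShellPattern hcpTwoShellPattern)
open Summit.AtomisticToContinuum.Crystallization.Theorems.OverbindingBudgetAffineCompressedCutDict (dict_step dict_base dict_reach_record
  dict_normClass_record)
open Summit.AtomisticToContinuum.Crystallization.Theorems.OverbindingBudgetAffineCompressedCutClasses (frame_insert_zero dict_gram_record dist_sq_class)
open Summit.AtomisticToContinuum.Crystallization.Theorems.OverbindingBudgetAffineCompressedCutOp (exists_coords_of_tetra linearIndependent_of_tetra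
  transport_step_exists)
open Summit.AtomisticToContinuum.Crystallization.Theorems.OverbindingBudgetAffineCompressedCutStep (tetra_exists_pattern partners_tetra site_ne_of_adjacent
  dist_base_le)

variable {N : ℕ}

/-! ## §1  Linear algebra of `ℝ³` around a tetrahedral unit triple -/

/-- A vector is determined by its inner products against a tetrahedral unit triple (the triple spans `ℝ³`, `…Op.exists_coords_of_tetra`). [this file] -/
theorem eq_of_inner_eq_tetra {p₀ p₁ p₂ : EuclideanSpace ℝ (Fin 3)} (g0 : ‖p₀‖ = 1) (g1 : ‖p₁‖ = 1) (g2 : ‖p₂‖ = 1)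
    (g01 : inner ℝ p₀ p₁ = 1 / 2) (g02 : inner ℝ p₀ p₂ = 1 / 2) (g12 : inner ℝ p₁ p₂ = 1 / 2) {x z : EuclideanSpace ℝ (Fin 3)}
    (h0 : inner ℝ x p₀ = inner ℝ z p₀) (h1 : inner ℝ x p₁ = inner ℝ z p₁) (h2 : inner ℝ x p₂ = inner ℝ z p₂) : x = z := by
  obtain ⟨c₀, c₁, c₂, hc⟩ := exists_coords_of_tetra g0 g1 g2 g01 g02 g12 (x - z)
  have d0 : inner ℝ (x - z) p₀ = 0 := by rw [inner_sub_left, h0, sub_self]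
  have d1 : inner ℝ (x - z) p₁ = 0 := by rw [inner_sub_left, h1, sub_self]
  have d2 : inner ℝ (x - z) p₂ = 0 := by rw [inner_sub_left, h2, sub_self]
  have hself : inner ℝ (x - z) (c₀ • p₀ + c₁ • p₁ + c₂ • p₂) = 0 := by
    rw [inner_add_right, inner_add_right, real_inner_smul_right, real_inner_smul_right, real_inner_smul_right, d0, d1, d2]
    ring
  rw [← hc] at hself
  exact sub_eq_zero.mp (inner_self_eq_zero.mp hself)

/-- Two linear maps of `ℝ³` agreeing on a linearly independent triple are equal. [folklore; this file] -/
theorem linearMap_eq_of_eq_on_triple {T T' : EuclideanSpace ℝ (Fin 3) →ₗ[ℝ] EuclideanSpace ℝ (Fin 3)} {u : Fin 3 → EuclideanSpace ℝ (Fin 3)}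
    (hu : LinearIndependent ℝ u) (h : ∀ i, T (u i) = T' (u i)) : T = T' :=
  LinearMap.ext_on_range (hu.span_eq_top_of_card_eq_finrank (by rw [Fintype.card_fin, finrank_euclideanSpace_fin])) h

/-- If `v_k, e, a` are linearly independent then so are the partners `e − v_k, −v_k, a − v_k`. [this file] -/
theorem linearIndependent_partners {vk e a : EuclideanSpace ℝ (Fin 3)} (h : LinearIndependent ℝ ![vk, e, a]) :
    LinearIndependent ℝ ![e - vk, -vk, a - vk] := by
  rw [Fintype.linearIndependent_iff] at h ⊢
  intro g hg
  have hs : ∑ i, g i • ![e - vk, -vk, a - vk] i = ∑ i, (![-g 0 - g 1 - g 2, g 0, g 2] i) • ![vk, e, a] i := by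
    simp only [Fin.sum_univ_three, Matrix.cons_val_zero, Matrix.cons_val_one, Matrix.cons_val, smul_sub, smul_neg, sub_smul, neg_smul]
    abel
  rw [hs] at hg
  have h' := h _ hg
  have e0 : -g 0 - g 1 - g 2 = 0 := by simpa using h' 0
  have e1 : g 0 = 0 := by simpa using h' 1
  have e2 : g 2 = 0 := by simpa using h' 2
  intro i
  fin_cases i
  · exact e1
  · show g 1 = 0
    linarith
  · exact e2

/-! ## §2  Distance classes within the record reach -/

/-- Distinct points of a two-shell pattern within the record reach `149/100` of each other are at distance `1` or `√2` (the class set of `…Classes.dist_sq_class`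
below `8/3`). [this file] -/
theorem norm_sub_class_of_reach {P : Finset (EuclideanSpace ℝ (Fin 3))} (hP : P = fccTwoShellPattern ∨ P = hcpTwoShellPattern)
    {v vk : EuclideanSpace ℝ (Fin 3)} (hv : v ∈ P) (hvk : vk ∈ P) (hne : v ≠ vk) (hvv : ‖v - vk‖ ≤ 149 / 100) :
    ‖v - vk‖ = 1 ∨ ‖v - vk‖ = Real.sqrt 2 := by
  obtain ⟨q, hq, hqd⟩ := dist_sq_class hP hv hvk
  rw [dist_eq_norm] at hqd
  have h0 : 0 < ‖v - vk‖ := norm_pos_iff.mpr (sub_ne_zero.mpr hne)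
  have hq0 : (0 : ℝ) < q := by rw [← hqd]; positivity
  have hq3 : (q : ℝ) < 8 / 3 := by rw [← hqd]; nlinarith [norm_nonneg (v - vk)]
  have hq0' : (0 : ℚ) < q := by exact_mod_cast hq0
  have hq3' : q < 8 / 3 := by
    have h' : (q : ℝ) < ((8 / 3 : ℚ) : ℝ) := by push_cast; exact hq3
    exact_mod_cast h'
  have hq12 : q = 1 ∨ q = 2 := by
    simp only [Finset.mem_insert, Finset.mem_singleton] at hq
    rcases hq with rfl | rfl | rfl | rfl | rfl | rfl | rfl | rfl | rfl | rfl | rfl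
    all_goals first | (left; rfl) | (right; rfl) | (exfalso; revert hq0' hq3'; norm_num)
  rcases hq12 with rfl | rfl
  · left
    have h1 : ‖v - vk‖ ^ 2 = 1 ^ 2 := by rw [hqd]; norm_num
    exact (pow_left_inj₀ (norm_nonneg _) zero_le_one two_ne_zero).mp h1
  · right
    rw [← Real.sqrt_sq (norm_nonneg (v - vk)), hqd]
    norm_num

/-! ## §3  The exact dictionary of a registered bond -/

/-- **EXACT DICTIONARY** of the bond `j → k = f v_k` under the linear isometry `R₁` (frames `(P, f)` at `j`, `(P', f')` at `k`): the back-pointer `w₀ ∈ P'`,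
`f' w₀ = y j`, has `R₁ w₀ = −v_k`, and every pattern point `v ∈ P` of `j` other than `v_k` within the record reach `‖v − v_k‖ ≤ 149/100` has a partner `w ∈ P'`
registering the same site, `f' w = f v`, with `R₁ w = v − v_k` exactly. [this file] -/
def ExactDict (y : Fin N → EuclideanSpace ℝ (Fin 3)) (j : Fin N) (P P' : Finset (EuclideanSpace ℝ (Fin 3)))
    (f f' : EuclideanSpace ℝ (Fin 3) → EuclideanSpace ℝ (Fin 3)) (vk : EuclideanSpace ℝ (Fin 3))
    (R₁ : EuclideanSpace ℝ (Fin 3) →ₗᵢ[ℝ] EuclideanSpace ℝ (Fin 3)) : Prop :=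
  (∃ w₀ ∈ P', f' w₀ = y j ∧ R₁ w₀ = -vk) ∧
    ∀ v ∈ P, v ≠ vk → ‖v - vk‖ ≤ 149 / 100 → ∃ w ∈ P', f' w = f v ∧ R₁ w = v - vk

/-- ★★ **EXACT TRANSPORT STEP AT THE RECORD CONSTANTS.**  Same setting as `…CompressedCutStep.transport_step_record` (sites `j`, frame `A, Q, P, f`, and
`k = f v_k`, frame `A', Q', P', f'`, `v_k ∈ P` first-shell, `(ε, θ, g) = (10⁻⁴, 10⁻³, 1/450)`, `k` exhaustive, patterns in `{fcc, hcp}`, SCALE comparison) plus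
injectivity of `f` on `P` (a clause of `AffFramed`): there is an EXACT linear isometry `R₁` with the op-norm transport bound
`‖nn_k·A' x − nn_j·A (R₁ x)‖ ≤ (5/2)·(2ε·nn_j + ε·nn_k)·‖x‖` AND the full exact dictionary `ExactDict y j P P' f f' v_k R₁`.
Assembly: the record step's frame (`tetra_exists_pattern`, `dict_base`, `dict_step`, `dict_normClass_record`, `dict_gram_record`, `transport_step_exists`), then
for each `v` in reach: `dict_reach_record` → `dict_step` → `norm_sub_class_of_reach` + `dict_normClass_record` → `dict_gram_record` against the frame →
`eq_of_inner_eq_tetra`. [this file] -/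
theorem exact_step_record {y : Fin N → EuclideanSpace ℝ (Fin 3)} {j k : Fin N}
    {A A' : EuclideanSpace ℝ (Fin 3) →ₗ[ℝ] EuclideanSpace ℝ (Fin 3)} {Q Q' : EuclideanSpace ℝ (Fin 3) →ₗᵢ[ℝ] EuclideanSpace ℝ (Fin 3)}
    {P P' : Finset (EuclideanSpace ℝ (Fin 3))} {f f' : EuclideanSpace ℝ (Fin 3) → EuclideanSpace ℝ (Fin 3)}
    (hs : 0 < nearestDist y j) (hsc : 9967 / 10000 * nearestDist y j ≤ nearestDist y k) (hsc' : nearestDist y k ≤ 10011 / 10000 * nearestDist y j)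
    (hP : P = fccTwoShellPattern ∨ P = hcpTwoShellPattern) (hP' : P' = fccTwoShellPattern ∨ P' = hcpTwoShellPattern)
    (hA : ∀ v ∈ P, ‖A v - Q v‖ ≤ 1 / 1000) (hA' : ∀ w ∈ P', ‖A' w - Q' w‖ ≤ 1 / 1000)
    (hfj : ∀ v ∈ P, f v ∈ Set.range y ∧ dist (f v) (y j + nearestDist y j • A v) ≤ 1 / 10 ^ 4 * nearestDist y j)
    (hfk : ∀ w ∈ P', f' w ∈ Set.range y ∧ dist (f' w) (y k + nearestDist y k • A' w) ≤ 1 / 10 ^ 4 * nearestDist y k)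
    (hinj : Set.InjOn f ↑P)
    (hexk : ∀ m, m ≠ k → dist (y m) (y k) ≤ (3 / 2 + 1 / 450) * nearestDist y k → ∃ w ∈ P', f' w = y m)
    {vk : EuclideanSpace ℝ (Fin 3)} (hvk : vk ∈ P) (hvk1 : ‖vk‖ = 1) (hfvk : f vk = y k) (hjk : j ≠ k) :
    ∃ R₁ : EuclideanSpace ℝ (Fin 3) →ₗᵢ[ℝ] EuclideanSpace ℝ (Fin 3),
      (∀ x, ‖nearestDist y k • A' x - nearestDist y j • A (R₁ x)‖ ≤
        5 / 2 * (2 * (1 / 10 ^ 4) * nearestDist y j + 1 / 10 ^ 4 * nearestDist y k) * ‖x‖) ∧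
      ExactDict y j P P' f f' vk R₁ := by
  set s := nearestDist y j with hs_def
  set s' := nearestDist y k with hs'_def
  have hs'0 : 0 ≤ s' := nearestDist_nonneg y k
  have hε0 : 0 ≤ 1 / 10 ^ 4 * s := by positivity
  -- the back-pointer
  have hdjk : dist (y j) (y k) ≤ (3 / 2 + 1 / 450) * s' := dist_base_le hA hfj hvk hvk1 hfvk hsc
  obtain ⟨w₀, hw₀, hfw₀, hin₀⟩ := dict_base hfj hfk hexk hvk hfvk hjk hdjk
  have h₀ : ‖s' • A' w₀ - s • (A 0 - A vk)‖ ≤ 2 * (1 / 10 ^ 4) * s + 1 / 10 ^ 4 * s' := by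
    rw [map_zero, zero_sub, smul_neg, sub_neg_eq_add]
    linarith
  -- the tetrahedron {0, vk, b, c} in P and its k-preimages
  obtain ⟨b, hb, c, hc, hb1, hc1, dvb, dvc, dbc, ivb, ivc, ibc⟩ := tetra_exists_pattern hP hvk hvk1
  have hne_b : f b ≠ y k := by rw [← hfvk]; exact site_ne_of_adjacent hs hA hfj hb hvk (by rw [dist_comm]; exact dvb)
  have hne_c : f c ≠ y k := by rw [← hfvk]; exact site_ne_of_adjacent hs hA hfj hc hvk (by rw [dist_comm]; exact dvc)
  have nbv : ‖b - vk‖ = 1 := by rw [← dist_eq_norm, dist_comm]; exact dvb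
  have ncv : ‖c - vk‖ = 1 := by rw [← dist_eq_norm, dist_comm]; exact dvc
  have hdb : dist (f b) (y k) ≤ (3 / 2 + 1 / 450) * s' := dict_reach_record hA hfj hvk hfvk hb hsc (by rw [nbv]; norm_num)
  have hdc : dist (f c) (y k) ≤ (3 / 2 + 1 / 450) * s' := dict_reach_record hA hfj hvk hfvk hc hsc (by rw [ncv]; norm_num)
  obtain ⟨w₁, hw₁, hfw₁, h₁⟩ := dict_step hfj hfk hexk hvk hfvk hb hne_b hdb
  obtain ⟨w₂, hw₂, hfw₂, h₂⟩ := dict_step hfj hfk hexk hvk hfvk hc hne_c hdc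
  -- norm classes of the preimages
  have hθ : (0 : ℝ) ≤ 1 / 1000 := by norm_num
  have hA0 := frame_insert_zero hθ hA
  have h0P : (0 : EuclideanSpace ℝ (Fin 3)) ∈ insert (0 : EuclideanSpace ℝ (Fin 3)) P := Finset.mem_insert_self 0 P
  have hvkP : vk ∈ insert (0 : EuclideanSpace ℝ (Fin 3)) P := Finset.mem_insert_of_mem hvk
  have n₀ : ‖w₀‖ = 1 :=
    (dict_normClass_record hs hs'0 hsc hsc' hP' hA0 hA' h0P hvkP hw₀ h₀).1 (by rw [zero_sub, norm_neg, hvk1])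
  have n₁ : ‖w₁‖ = 1 := (dict_normClass_record hs hs'0 hsc hsc' hP' hA hA' hb hvk hw₁ h₁).1 nbv
  have n₂ : ‖w₂‖ = 1 := (dict_normClass_record hs hs'0 hsc hsc' hP' hA hA' hc hvk hw₂ h₂).1 ncv
  -- partners and Gram classes
  obtain ⟨g0, g1, g2, g01, g02, g12⟩ := partners_tetra hvk1 hb1 hc1 ivb ivc ibc
  have hw₀' : w₀ ∈ insert (0 : EuclideanSpace ℝ (Fin 3)) P' := Finset.mem_insert_of_mem hw₀
  have hw₁' : w₁ ∈ insert (0 : EuclideanSpace ℝ (Fin 3)) P' := Finset.mem_insert_of_mem hw₁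
  have hw₂' : w₂ ∈ insert (0 : EuclideanSpace ℝ (Fin 3)) P' := Finset.mem_insert_of_mem hw₂
  have hbP : b ∈ insert (0 : EuclideanSpace ℝ (Fin 3)) P := Finset.mem_insert_of_mem hb
  have hcP : c ∈ insert (0 : EuclideanSpace ℝ (Fin 3)) P := Finset.mem_insert_of_mem hc
  have e0 : (0 : EuclideanSpace ℝ (Fin 3)) - vk = -vk := zero_sub vk
  have i01 : inner ℝ w₀ w₁ = 1 / 2 := by
    rw [dict_gram_record hs hsc hsc' hP hP' hA hA' h0P hbP hw₀' hw₁' h₀ h₁ (by rw [n₀, e0, g0]) (by rw [n₁, g1]), e0, g01]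
  have i02 : inner ℝ w₀ w₂ = 1 / 2 := by
    rw [dict_gram_record hs hsc hsc' hP hP' hA hA' h0P hcP hw₀' hw₂' h₀ h₂ (by rw [n₀, e0, g0]) (by rw [n₂, g2]), e0, g02]
  have i12 : inner ℝ w₁ w₂ = 1 / 2 := by
    rw [dict_gram_record hs hsc hsc' hP hP' hA hA' hbP hcP hw₁' hw₂' h₁ h₂ (by rw [n₁, g1]) (by rw [n₂, g2]), g12]
  -- the abstract step
  have hd₀ : ‖(s' • A') w₀ - (s • A) (-vk)‖ ≤ 2 * (1 / 10 ^ 4) * s + 1 / 10 ^ 4 * s' := by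
    rw [LinearMap.smul_apply, LinearMap.smul_apply, map_neg, smul_neg, sub_neg_eq_add]; linarith
  have hd₁ : ‖(s' • A') w₁ - (s • A) (b - vk)‖ ≤ 2 * (1 / 10 ^ 4) * s + 1 / 10 ^ 4 * s' := by
    rw [LinearMap.smul_apply, LinearMap.smul_apply, map_sub]; exact h₁
  have hd₂ : ‖(s' • A') w₂ - (s • A) (c - vk)‖ ≤ 2 * (1 / 10 ^ 4) * s + 1 / 10 ^ 4 * s' := by
    rw [LinearMap.smul_apply, LinearMap.smul_apply, map_sub]; exact h₂
  obtain ⟨R₁, hR₀, hR₁, hR₂, hop⟩ := transport_step_exists n₀ n₁ n₂ i01 i02 i12 g0 g1 g2 g01 g02 g12 hd₀ hd₁ hd₂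
  refine ⟨R₁, fun x => ?_, ⟨w₀, hw₀, hfw₀, hR₀⟩, ?_⟩
  · have := hop x
    rwa [LinearMap.smul_apply, LinearMap.smul_apply] at this
  -- the full dictionary
  intro v hv hne hvv
  have hfne : f v ≠ y k := by
    rw [← hfvk]
    exact fun h => hne (hinj hv hvk h)
  have hdv : dist (f v) (y k) ≤ (3 / 2 + 1 / 450) * s' := dict_reach_record hA hfj hvk hfvk hv hsc hvv
  obtain ⟨w, hw, hfw, h⟩ := dict_step hfj hfk hexk hvk hfvk hv hfne hdv
  refine ⟨w, hw, hfw, ?_⟩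
  have hnc := dict_normClass_record hs hs'0 hsc hsc' hP' hA hA' hv hvk hw h
  have nw : ‖w‖ = ‖v - vk‖ := by
    rcases norm_sub_class_of_reach hP hv hvk hne hvv with hn | hn
    · rw [hn, hnc.1 hn]
    · rw [hn, hnc.2 hn]
  have hvP : v ∈ insert (0 : EuclideanSpace ℝ (Fin 3)) P := Finset.mem_insert_of_mem hv
  have hw' : w ∈ insert (0 : EuclideanSpace ℝ (Fin 3)) P' := Finset.mem_insert_of_mem hw
  have i0 := dict_gram_record hs hsc hsc' hP hP' hA hA' hvP h0P hw' hw₀' h h₀ nw (by rw [n₀, e0, g0])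
  rw [e0] at i0
  have i1 := dict_gram_record hs hsc hsc' hP hP' hA hA' hvP hbP hw' hw₁' h h₁ nw (by rw [n₁, g1])
  have i2 := dict_gram_record hs hsc hsc' hP hP' hA hA' hvP hcP hw' hw₂' h h₂ nw (by rw [n₂, g2])
  have j0 : inner ℝ (R₁ w) (-vk) = inner ℝ (v - vk) (-vk) := by
    calc inner ℝ (R₁ w) (-vk) = inner ℝ (R₁ w) (R₁ w₀) := by rw [hR₀]
      _ = inner ℝ w w₀ := R₁.inner_map_map w w₀
      _ = _ := i0
  have j1 : inner ℝ (R₁ w) (b - vk) = inner ℝ (v - vk) (b - vk) := by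
    calc inner ℝ (R₁ w) (b - vk) = inner ℝ (R₁ w) (R₁ w₁) := by rw [hR₁]
      _ = inner ℝ w w₁ := R₁.inner_map_map w w₁
      _ = _ := i1
  have j2 : inner ℝ (R₁ w) (c - vk) = inner ℝ (v - vk) (c - vk) := by
    calc inner ℝ (R₁ w) (c - vk) = inner ℝ (R₁ w) (R₁ w₂) := by rw [hR₂]
      _ = inner ℝ w w₂ := R₁.inner_map_map w w₂
      _ = _ := i2
  exact eq_of_inner_eq_tetra g0 g1 g2 g01 g02 g12 j0 j1 j2

/-! ## §4  Uniqueness and the cocycle -/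

/-- **The exact dictionary pins the isometry**: two exact dictionaries of the same bond coincide (the dictionary domain contains a tetrahedral frame at `v_k`,
whose three partners have independent images; `f'` is injective on `P'`, a clause of `AffFramed`). [this file] -/
theorem exactDict_unique {y : Fin N → EuclideanSpace ℝ (Fin 3)} {j : Fin N} {P P' : Finset (EuclideanSpace ℝ (Fin 3))}
    {f f' : EuclideanSpace ℝ (Fin 3) → EuclideanSpace ℝ (Fin 3)} {vk : EuclideanSpace ℝ (Fin 3)}
    (hP : P = fccTwoShellPattern ∨ P = hcpTwoShellPattern) (hinj' : Set.InjOn f' ↑P') (hvk : vk ∈ P) (hvk1 : ‖vk‖ = 1)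
    {R R' : EuclideanSpace ℝ (Fin 3) →ₗᵢ[ℝ] EuclideanSpace ℝ (Fin 3)} (hR : ExactDict y j P P' f f' vk R) (hR' : ExactDict y j P P' f f' vk R') :
    ∀ x, R x = R' x := by
  obtain ⟨b, hb, c, hc, hb1, hc1, dvb, dvc, -, ivb, ivc, ibc⟩ := tetra_exists_pattern hP hvk hvk1
  obtain ⟨g0, g1, g2, g01, g02, g12⟩ := partners_tetra hvk1 hb1 hc1 ivb ivc ibc
  have nbv : ‖b - vk‖ = 1 := by rw [← dist_eq_norm, dist_comm]; exact dvb
  have ncv : ‖c - vk‖ = 1 := by rw [← dist_eq_norm, dist_comm]; exact dvc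
  have hbne : b ≠ vk := fun h => by rw [h, sub_self, norm_zero] at nbv; exact zero_ne_one nbv
  have hcne : c ≠ vk := fun h => by rw [h, sub_self, norm_zero] at ncv; exact zero_ne_one ncv
  have hble : ‖b - vk‖ ≤ 149 / 100 := by rw [nbv]; norm_num
  have hcle : ‖c - vk‖ ≤ 149 / 100 := by rw [ncv]; norm_num
  obtain ⟨w₀, hw₀, hfw₀, hRw₀⟩ := hR.1
  obtain ⟨w₀', hw₀', hfw₀', hR'w₀'⟩ := hR'.1
  have e₀ : w₀' = w₀ := hinj' hw₀' hw₀ (by rw [hfw₀', hfw₀])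
  obtain ⟨w₁, hw₁, hfw₁, hRw₁⟩ := hR.2 b hb hbne hble
  obtain ⟨w₁', hw₁', hfw₁', hR'w₁'⟩ := hR'.2 b hb hbne hble
  have e₁ : w₁' = w₁ := hinj' hw₁' hw₁ (by rw [hfw₁', hfw₁])
  obtain ⟨w₂, hw₂, hfw₂, hRw₂⟩ := hR.2 c hc hcne hcle
  obtain ⟨w₂', hw₂', hfw₂', hR'w₂'⟩ := hR'.2 c hc hcne hcle
  have e₂ : w₂' = w₂ := hinj' hw₂' hw₂ (by rw [hfw₂', hfw₂])
  have hR'w₀ : R' w₀ = -vk := by rw [← e₀]; exact hR'w₀'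
  have hR'w₁ : R' w₁ = b - vk := by rw [← e₁]; exact hR'w₁'
  have hR'w₂ : R' w₂ = c - vk := by rw [← e₂]; exact hR'w₂'
  have hli : LinearIndependent ℝ ![w₀, w₁, w₂] := by
    apply LinearIndependent.of_comp R.toLinearMap
    have hc3 : (R.toLinearMap : EuclideanSpace ℝ (Fin 3) → EuclideanSpace ℝ (Fin 3)) ∘ ![w₀, w₁, w₂] = ![-vk, b - vk, c - vk] := by
      funext i
      fin_cases i <;> simp [hRw₀, hRw₁, hRw₂]
    rw [hc3]
    exact linearIndependent_of_tetra g0 g1 g2 g01 g02 g12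
  have key := linearMap_eq_of_eq_on_triple (T := R.toLinearMap) (T' := R'.toLinearMap) hli (fun i => by
    fin_cases i <;> simp [hRw₀, hRw₁, hRw₂, hR'w₀, hR'w₁, hR'w₂])
  intro x
  simpa using LinearMap.congr_fun key x

/-- ★ **COCYCLE OF EXACT DICTIONARIES** (two parents induce the same chart on a common child; obligation O5).  Sites `j` (pattern `P`, registration `f`),
`j₂ = f e` (pattern `P₂`, registration `f₂`, injective on `P₂`) and `k = f v_k = f₂ v_k'` (pattern `P'`, registration `f'`, injective on `P'`), `‖v_k‖ = 1`, with
exact dictionaries `R` of `j → j₂`, `R₁` of `j → k`, `R₁'` of `j₂ → k`; the three points `v_k, e` and one more `a ∈ P` are pairwise within the record reach and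
LINEARLY INDEPENDENT.  Then `R (R₁' x) = R₁ x` for every `x`: the chart of `k` through `j₂` equals the chart through `j`.
Proof: `R ∘ R₁'` and `R₁` agree on the three partners in `P'` of `e`, of the centre of `j`, and of `a` (site bookkeeping through the injective registrations),
whose `R₁`-images `e − v_k, −v_k, a − v_k` are independent (`linearIndependent_partners`). [this file] -/
theorem exactDict_cocycle {y : Fin N → EuclideanSpace ℝ (Fin 3)} {j j₂ k : Fin N} {P P₂ P' : Finset (EuclideanSpace ℝ (Fin 3))}
    {f f₂ f' : EuclideanSpace ℝ (Fin 3) → EuclideanSpace ℝ (Fin 3)} {vk e a vk' : EuclideanSpace ℝ (Fin 3)}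
    {R R₁ R₁' : EuclideanSpace ℝ (Fin 3) →ₗᵢ[ℝ] EuclideanSpace ℝ (Fin 3)}
    (hinj₂ : Set.InjOn f₂ ↑P₂) (hinj' : Set.InjOn f' ↑P')
    (hvk : vk ∈ P) (hvk1 : ‖vk‖ = 1) (he : e ∈ P) (ha : a ∈ P) (hfvk : f vk = y k) (hfe : f e = y j₂)
    (hvk' : vk' ∈ P₂) (hfvk' : f₂ vk' = y k)
    (hevk : e ≠ vk) (hde : ‖e - vk‖ ≤ 149 / 100) (havk : a ≠ vk) (hda : ‖a - vk‖ ≤ 149 / 100) (hae : a ≠ e) (hdae : ‖a - e‖ ≤ 149 / 100)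
    (hli : LinearIndependent ℝ ![vk, e, a])
    (hR : ExactDict y j P P₂ f f₂ e R) (hR₁ : ExactDict y j P P' f f' vk R₁) (hR₁' : ExactDict y j₂ P₂ P' f₂ f' vk' R₁') :
    ∀ x, R (R₁' x) = R₁ x := by
  -- (a) the partner of `e` in `P'` is the back-pointer of the bond `j₂ → k`; `R v_k' = v_k − e`
  obtain ⟨w₀', hw₀', hfw₀', hw₀'R⟩ := hR₁'.1
  obtain ⟨wa, hwa, hfwa, hwaR⟩ := hR₁.2 e he hevk hde
  have ea : wa = w₀' := hinj' hwa hw₀' (by rw [hfwa, hfw₀', hfe])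
  have hw₀'R₁ : R₁ w₀' = e - vk := by rw [← ea]; exact hwaR
  obtain ⟨u, hu, hfu, huR⟩ := hR.2 vk hvk hevk.symm (by rw [norm_sub_rev]; exact hde)
  have eu : u = vk' := hinj₂ hu hvk' (by rw [hfu, hfvk, hfvk'])
  have hvk'R : R vk' = vk - e := by rw [← eu]; exact huR
  -- (b) the partner of the centre of `j` in `P'` is the back-pointer of the bond `j → k`
  obtain ⟨w₀, hw₀, hfw₀, hw₀R⟩ := hR₁.1
  obtain ⟨u₀, hu₀, hfu₀, hu₀R⟩ := hR.1
  have hd₀ : ‖u₀ - vk'‖ = 1 := by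
    rw [← R.norm_map, map_sub, hu₀R, hvk'R, show -e - (vk - e) = -vk by abel, norm_neg, hvk1]
  have hu₀ne : u₀ ≠ vk' := fun h => by rw [h, sub_self, norm_zero] at hd₀; exact zero_ne_one hd₀
  obtain ⟨wb, hwb, hfwb, hwbR⟩ := hR₁'.2 u₀ hu₀ hu₀ne (by rw [hd₀]; norm_num)
  have eb : wb = w₀ := hinj' hwb hw₀ (by rw [hfwb, hfu₀, hfw₀])
  have hw₀R₁' : R₁' w₀ = u₀ - vk' := by rw [← eb]; exact hwbR
  -- (c) the partners of `a`
  obtain ⟨wc, hwc, hfwc, hwcR⟩ := hR₁.2 a ha havk hda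
  obtain ⟨uc, huc, hfuc, hucR⟩ := hR.2 a ha hae hdae
  have hdc : ‖uc - vk'‖ = ‖a - vk‖ := by
    rw [← R.norm_map, map_sub, hucR, hvk'R, show a - e - (vk - e) = a - vk by abel]
  have hucne : uc ≠ vk' := fun h => havk (by
    rw [h, sub_self, norm_zero] at hdc
    exact sub_eq_zero.mp (norm_eq_zero.mp hdc.symm))
  obtain ⟨wc', hwc', hfwc', hwc'R⟩ := hR₁'.2 uc huc hucne (by rw [hdc]; exact hda)
  have ec : wc' = wc := hinj' hwc' hwc (by rw [hfwc', hfuc, hfwc])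
  have hwcR₁' : R₁' wc = uc - vk' := by rw [← ec]; exact hwc'R
  -- agreement on the three partners
  have a1 : R (R₁' w₀') = R₁ w₀' := by rw [hw₀'R, map_neg, hvk'R, hw₀'R₁, neg_sub]
  have a2 : R (R₁' w₀) = R₁ w₀ := by rw [hw₀R₁', map_sub, hu₀R, hvk'R, hw₀R]; abel
  have a3 : R (R₁' wc) = R₁ wc := by rw [hwcR₁', map_sub, hucR, hvk'R, hwcR]; abel
  have hli' : LinearIndependent ℝ ![w₀', w₀, wc] := by
    apply LinearIndependent.of_comp R₁.toLinearMap
    have hc3 : (R₁.toLinearMap : EuclideanSpace ℝ (Fin 3) → EuclideanSpace ℝ (Fin 3)) ∘ ![w₀', w₀, wc] = ![e - vk, -vk, a - vk] := by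
      funext i
      fin_cases i <;> simp [hw₀'R₁, hw₀R, hwcR]
    rw [hc3]
    exact linearIndependent_partners hli
  have key := linearMap_eq_of_eq_on_triple (T := R.toLinearMap ∘ₗ R₁'.toLinearMap) (T' := R₁.toLinearMap) hli' (fun i => by
    fin_cases i <;> simp [a1, a2, a3])
  intro x
  simpa using LinearMap.congr_fun key x

end Summit.AtomisticToContinuum.Crystallization.Theorems.OverbindingBudgetAffineCompressedCutExact
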